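import Summits.CriticalPhenomena.PercolationContinuityZ3.Theorems.SubpolynomialBlocking.Negative.Strengthenings
import Literature.Probability.Percolation.BondPercolationSymmetry
import HarnessLib

/-!
# Crux `PercNonProliferation.SubpolynomialBlocking` (stmt-CriticalPhenomena-4446), line `root-trick-wall-patch` — stub `stub_annulusCrossing_renorm`

Helper file for the lead's skeleton of the line `root-trick-wall-patch` of the crux
`Summit.CriticalPhenomena.PercolationContinuityZ3.Theses.PercNonProliferation.SubpolynomialBlocking`.
Proves exactly the registered stub signature `stub_annulusCrossing_renorm`; lands with
`--supports stmt-CriticalPhenomena-4446`.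

## The statement (renormalisation inequality `a_{20n} ≤ (100^d a_n)²`)

Write `a_n(p) = P_p(annulusCrossing d n)` for the probability that the inner box `Λ_n = [-n, n]^d`
is joined to `∂ⁱⁿΛ_{2n}` by an open path inside `Λ_{2n}`. Then for every `d`, every `p` and every
`n ≥ 1`: `a_{20n}(p) ≤ (100^d · a_n(p))²` (quasi-multiplicativity, upper direction; only the
independence of disjoint shells is used, no BK inequality).

## The argument

Work on lattice configurations `ω ⊆ E(ℤ^d)` (`DCT16.real_mono_of_forall_subset_edgeSet`), and let
`T_v = {(v + Λ_n) ⟷ (v + ∂ⁱⁿΛ_{2n}) in v + Λ_{2n}}` be the translate of `annulusCrossing d n` by `v`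
(written as an `openCrossing` of the three translated sets); `P_p(T_v) = a_n` by translation
invariance (`real_openCrossing_shift`, Grimmett 1999 §1.6).
* MARKERS (`StubAnnulusCrossingRenorm.exists_grid_crossing`). An open path `P` inside `Λ_{40n}`
  from `u ∈ Λ_{20n}` to `w ∈ ∂ⁱⁿΛ_{40n}` has a LAST EXIT edge `a ∼ b` from `Λ_K` (`PathIn.last_exit`),
  `‖b‖_∞ = K + 1`, followed by an open path `Q` from `b` to `w`. Round `b` down to the grid
  `n ℤ^d`: `x = n • z`, `z_i = ⌊b_i / n⌋`, so `b ∈ x + Λ_n`, `x ∈ Λ_{K+n} ∖ Λ_{K-n}`, `z ∈ Λ_{40}`, and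
  `w ∉ x + Λ_{2n}` as soon as `‖w‖_∞ > K + 4n`. The FIRST EXIT of `Q` from `x + Λ_{2n}`
  (`PathIn.exit`) ends at a translate of an inner-boundary vertex of `Λ_{2n}`
  (`mem_innerBoundary_iff`, `DCT16.zdGraph_adj_sub_iff`), so `ω ∈ T_x`
  (`StubAnnulusCrossingRenorm.mem_openCrossing_of_pathIn`). With `K = 25n` and `K = 33n` this
  gives grid points `x₁ ∈ Λ_{26n} ∖ Λ_{24n}`, `x₂ ∈ Λ_{34n} ∖ Λ_{32n}` with `ω ∈ T_{x₁} ∩ T_{x₂}`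
  (`StubAnnulusCrossingRenorm.mem_inter_of_mem_annulusCrossing`).
* DISJOINT SUPPORTS. For `v ∈ I₁ = nΛ_{40} ∩ Λ_{26n} ∖ Λ_{24n}` the event `T_v` is determined by the
  pairs inside `S₁ = Λ_{28n} ∖ Λ_{22n}`, for `v ∈ I₂ = nΛ_{40} ∩ Λ_{34n} ∖ Λ_{32n}` by the pairs inside
  `S₂ = Λ_{36n} ∖ Λ_{30n}` (`DCT16.determinedBy_openConnIn`), and `S₁ ∩ S₂ = ∅`; hence
  `P(U₁ ∩ U₂) = P(U₁) P(U₂)` for `U_k = ⋃_{v ∈ I_k} T_v` (`DCT16.real_inter_of_determinedBy_disjoint`,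
  Grimmett 1999 §2.2).
* UNION BOUND. `P(U_k) ≤ |I_k| a_n ≤ 81^d a_n ≤ 100^d a_n` (`measureReal_biUnion_finset_le`,
  `card_box`), so `a_{20n} ≤ P(U₁ ∩ U₂) ≤ (100^d a_n)²`.

No new definitions; the index sets and shells are written as explicit `Finset` expressions.
-/

noncomputable section

namespace Summit.CriticalPhenomena.PercolationContinuityZ3.Theorems.SubpolynomialBlocking

open MeasureTheory Filter Topology
open Literature.Probability.Percolation Literature.Probability.LatticeModels
open Literature.Barriers.CriticalPhenomena
open Literature.Probability.Percolation.DCT16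

namespace StubAnnulusCrossingRenorm

/-! ### Geometry: translated boxes, local crossings, markers on the grid `n ℤ^d` -/

/-- Membership in a translated finite set of sites: `z ∈ Λ + x ↔ z - x ∈ Λ`. -/
theorem mem_image_add_iff {d : ℕ} (x z : Site d) (Λ : Finset (Site d)) :
    z ∈ (· + x) '' (↑Λ : Set (Site d)) ↔ z - x ∈ Λ := by
  constructor
  · rintro ⟨w, hw, rfl⟩
    simpa only [Finset.mem_coe, add_sub_cancel_right] using hw
  · intro h
    exact ⟨z - x, Finset.mem_coe.2 h, sub_add_cancel z x⟩

/-- **Local crossing by first exit.** On a lattice configuration `ω ⊆ E(ℤ^d)`, an open path (inside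
any set) from a point `b ∈ x + Λ_n` to a point `w ∉ x + Λ_{2n}` contains an open path inside
`x + Λ_{2n}` from `b` to a point of `x + ∂ⁱⁿΛ_{2n}`: stop at the first exit from `x + Λ_{2n}`
(`PathIn.exit`); the last vertex before the exit has a lattice neighbour outside, i.e. is a
translate of an inner-boundary vertex (`mem_innerBoundary_iff`, `DCT16.zdGraph_adj_sub_iff`). -/
theorem mem_openCrossing_of_pathIn {d n : ℕ} {ω : BondConfig (Site d)}
    (hω : ω ⊆ (zdGraph d).edgeSet) {A : Set (Site d)} {x b w : Site d}
    (h : PathIn (openGraph ω) A b w) (hb : b - x ∈ box d n) (hw : w - x ∉ box d (2 * n)) :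
    ω ∈ openCrossing ((· + x) '' (↑(box d (2 * n)) : Set (Site d)))
      ((· + x) '' (↑(box d n) : Set (Site d)))
      ((· + x) '' (↑(innerBoundary (zdGraph d) (box d (2 * n))) : Set (Site d))) := by
  have hbR : b ∈ (· + x) '' (↑(box d (2 * n)) : Set (Site d)) :=
    (mem_image_add_iff x b _).2 (box_mono d (by omega) hb)
  have hwR : w ∉ (· + x) '' (↑(box d (2 * n)) : Set (Site d)) := fun h' =>
    hw ((mem_image_add_iff x w _).1 h')
  obtain ⟨a', b', ha', hb', -, hab', hpath⟩ := h.exit hbR hwR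
  refine ⟨b, (mem_image_add_iff x b _).2 hb, a', (mem_image_add_iff x a' _).2 ?_,
    mem_openConnIn_of_pathIn (hpath.mono Set.inter_subset_left)⟩
  rw [mem_innerBoundary_iff]
  exact ⟨(mem_image_add_iff x a' _).1 ha', b' - x,
    fun hb'' => hb' ((mem_image_add_iff x b' _).2 hb''),
    (zdGraph_adj_sub_iff x a' b').2 (adj_of_openGraph_adj hω hab')⟩

/-- **Marker on the grid.** On a lattice configuration `ω ⊆ E(ℤ^d)`, let an open path run from
`u ∈ Λ_K` to `w ∉ Λ_{K'}`, where `n ≥ 1`, `M + n ≤ K`, `K + n ≤ L`, `K + 4n ≤ K'`, `K + 1 ≤ 40n`. Its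
last exit edge from `Λ_K` (`PathIn.last_exit`) ends at a vertex `b` with `‖b‖_∞ = K + 1`
(`DCT16.mem_box_succ_of_adj`); rounding `b` down to the grid, `x = n • z` with `z_i = ⌊b_i / n⌋`,
gives `z ∈ Λ_{40}`, `x ∈ Λ_L ∖ Λ_M`, `b ∈ x + Λ_n` and `w ∉ x + Λ_{2n}`, so the remaining path from `b`
to `w` produces the local crossing `ω ∈ T_x` (`mem_openCrossing_of_pathIn`). -/
theorem exists_grid_crossing {d n K L M K' : ℕ} (hn : 1 ≤ n) (hL : K + n ≤ L) (hM : M + n ≤ K)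
    (hK' : K + 4 * n ≤ K') (h40 : K + 1 ≤ 40 * n) {ω : BondConfig (Site d)}
    (hω : ω ⊆ (zdGraph d).edgeSet) {A : Set (Site d)} {u w : Site d}
    (h : PathIn (openGraph ω) A u w) (hu : u ∈ box d K) (hw : w ∉ box d K') :
    ∃ z ∈ box d 40, ((n : ℤ) • z ∈ box d L ∧ (n : ℤ) • z ∉ box d M) ∧
      ω ∈ openCrossing ((· + (n : ℤ) • z) '' (↑(box d (2 * n)) : Set (Site d)))
        ((· + (n : ℤ) • z) '' (↑(box d n) : Set (Site d)))
        ((· + (n : ℤ) • z) '' (↑(innerBoundary (zdGraph d) (box d (2 * n))) : Set (Site d))) := by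
  have hwK : w ∉ (↑(box d K) : Set (Site d)) := fun h' =>
    hw (box_mono d (by omega) (Finset.mem_coe.1 h'))
  obtain ⟨a, b, ha, -, hb, hab, Q⟩ :=
    h.last_exit (C := (↑(box d K) : Set (Site d))) (Finset.mem_coe.2 hu) hwK
  have hbK : b ∈ box d (K + 1) :=
    DCT16.mem_box_succ_of_adj (Finset.mem_coe.1 ha) (adj_of_openGraph_adj hω hab)
  rw [mem_box] at hbK
  have hbK' : ¬ ∀ i, -(K : ℤ) ≤ b i ∧ b i ≤ K := fun h' => hb (Finset.mem_coe.2 (mem_box.2 h'))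
  obtain ⟨j, hj⟩ := not_forall.1 hbK'
  -- grid rounding `z i = ⌊b i / n⌋`
  obtain ⟨z, hz⟩ : ∃ z : Site d, ∀ i, z i = b i / (n : ℤ) := ⟨fun i => b i / (n : ℤ), fun _ => rfl⟩
  have hround : ∀ i, (n : ℤ) * z i ≤ b i ∧ b i < (n : ℤ) * z i + n := fun i => by
    have h1 := Int.mul_ediv_add_emod (b i) n
    have h2 := Int.emod_nonneg (b i) (show (n : ℤ) ≠ 0 by omega)
    have h3 := Int.emod_lt_of_pos (b i) (show (0 : ℤ) < n by omega)
    rw [← hz i] at h1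
    constructor <;> omega
  refine ⟨z, ?_, ⟨?_, ?_⟩, mem_openCrossing_of_pathIn hω Q ?_ ?_⟩
  · -- `z ∈ Λ_{40}`: `|b i| ≤ K + 1 ≤ 40 n`
    rw [mem_box]
    intro i
    have hi := hbK i
    rw [hz i]
    exact ⟨Int.le_ediv_of_mul_le (by omega) (by push_cast at hi ⊢; omega),
      Int.ediv_le_of_le_mul (by omega) (by push_cast at hi ⊢; omega)⟩
  · -- `n • z ∈ Λ_L`
    rw [mem_box]
    intro i
    have hi := hbK i
    have hr := hround i
    simp only [Pi.smul_apply, smul_eq_mul]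
    push_cast at hi ⊢
    omega
  · -- `n • z ∉ Λ_M`: the coordinate `j` with `|b j| = K + 1`
    rw [mem_box, not_forall]
    refine ⟨j, ?_⟩
    have hr := hround j
    simp only [Pi.smul_apply, smul_eq_mul]
    omega
  · -- `b ∈ n • z + Λ_n`
    rw [mem_box]
    intro i
    have hr := hround i
    simp only [Pi.sub_apply, Pi.smul_apply, smul_eq_mul]
    omega
  · -- `w ∉ n • z + Λ_{2n}`: `‖w‖_∞ ≥ K' + 1 > ‖n • z‖_∞ + 2n`
    rw [mem_box, not_forall] at hw ⊢
    obtain ⟨i, hi⟩ := hw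
    refine ⟨i, ?_⟩
    have hr := hround i
    have hi' := hbK i
    simp only [Pi.sub_apply, Pi.smul_apply, smul_eq_mul]
    push_cast at hi hi' ⊢
    omega

/-- **Shell containment.** If `v ∈ Λ_L ∖ Λ_M` with `L + 2n ≤ L'` and `M' + 2n ≤ M`, then
`v + Λ_{2n} ⊆ Λ_{L'} ∖ Λ_{M'}`. -/
theorem add_mem_sdiff {d n L M L' M' : ℕ} (hL : L + 2 * n ≤ L') (hM : M' + 2 * n ≤ M)
    {v z : Site d} (hv : v ∈ box d L) (hv' : v ∉ box d M) (hz : z ∈ box d (2 * n)) :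
    z + v ∈ box d L' \ box d M' := by
  rw [Finset.mem_sdiff, mem_box, mem_box]
  rw [mem_box] at hv hv' hz
  obtain ⟨j, hj⟩ := not_forall.1 hv'
  refine ⟨fun i => ?_, fun h' => ?_⟩
  · have h1 := hv i
    have h2 := hz i
    simp only [Pi.add_apply]
    push_cast at h1 h2 ⊢
    omega
  · have h1 := h' j
    have h2 := hz j
    simp only [Pi.add_apply] at h1
    push_cast at h1 h2 hj
    omega

/-- **Two markers.** On a lattice configuration `ω ⊆ E(ℤ^d)` crossing the annulus
`Λ_{40n} ∖ Λ_{20n}` (`n ≥ 1`), there are grid points `x₁ ∈ nΛ_{40} ∩ Λ_{26n} ∖ Λ_{24n}` and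
`x₂ ∈ nΛ_{40} ∩ Λ_{34n} ∖ Λ_{32n}` with `ω ∈ T_{x₁} ∩ T_{x₂}` (`exists_grid_crossing` with `K = 25n`
and `K = 33n`, applied to the open path of `DCT16.mem_openConnIn_iff_pathIn`; the endpoint on
`∂ⁱⁿΛ_{40n}` is outside `Λ_{29n}` and `Λ_{37n}`, `DCT16.notMem_box_of_mem_innerBoundary_box`). -/
theorem mem_inter_of_mem_annulusCrossing {d n : ℕ} (hn : 1 ≤ n) {ω : BondConfig (Site d)}
    (hω : ω ⊆ (zdGraph d).edgeSet) (h : ω ∈ annulusCrossing d (20 * n)) :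
    ω ∈ (⋃ v ∈ ((((box d 40).image fun z : Site d => (n : ℤ) • z) ∩ box d (26 * n)) \
          box d (24 * n)),
        openCrossing ((· + v) '' (↑(box d (2 * n)) : Set (Site d)))
          ((· + v) '' (↑(box d n) : Set (Site d)))
          ((· + v) '' (↑(innerBoundary (zdGraph d) (box d (2 * n))) : Set (Site d)))) ∩
      (⋃ v ∈ ((((box d 40).image fun z : Site d => (n : ℤ) • z) ∩ box d (34 * n)) \
          box d (32 * n)),
        openCrossing ((· + v) '' (↑(box d (2 * n)) : Set (Site d)))
          ((· + v) '' (↑(box d n) : Set (Site d)))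
          ((· + v) '' (↑(innerBoundary (zdGraph d) (box d (2 * n))) : Set (Site d)))) := by
  obtain ⟨u, hu, w, hw, huw⟩ := h
  have P := mem_openConnIn_iff_pathIn.1 huw
  have hw₁ : w ∉ box d (29 * n) := notMem_box_of_mem_innerBoundary_box (by omega) hw
  have hw₂ : w ∉ box d (37 * n) := notMem_box_of_mem_innerBoundary_box (by omega) hw
  have hu₁ : u ∈ box d (25 * n) := box_mono d (by omega) hu
  have hu₂ : u ∈ box d (33 * n) := box_mono d (by omega) hu
  obtain ⟨z₁, hz₁, ⟨hL₁, hM₁⟩, hT₁⟩ := exists_grid_crossing (K := 25 * n) (L := 26 * n)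
    (M := 24 * n) (K' := 29 * n) hn (by omega) (by omega) (by omega) (by omega) hω P hu₁ hw₁
  obtain ⟨z₂, hz₂, ⟨hL₂, hM₂⟩, hT₂⟩ := exists_grid_crossing (K := 33 * n) (L := 34 * n)
    (M := 32 * n) (K' := 37 * n) hn (by omega) (by omega) (by omega) (by omega) hω P hu₂ hw₂
  refine ⟨Set.mem_biUnion (Finset.mem_coe.2 ?_) hT₁, Set.mem_biUnion (Finset.mem_coe.2 ?_) hT₂⟩
  · exact Finset.mem_sdiff.2 ⟨Finset.mem_inter.2 ⟨Finset.mem_image_of_mem _ hz₁, hL₁⟩, hM₁⟩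
  · exact Finset.mem_sdiff.2 ⟨Finset.mem_inter.2 ⟨Finset.mem_image_of_mem _ hz₂, hL₂⟩, hM₂⟩

/-! ### Probability: translation invariance, locality, independence, union bound -/

/-- **Translation invariance**: `P_p(T_v) = a_n` for every `v` (`real_openCrossing_shift`,
Grimmett 1999 §1.6; `annulusCrossing d n` is the open crossing of `Λ_{2n}` from `Λ_n` to `∂ⁱⁿΛ_{2n}`
definitionally). -/
theorem real_openCrossing_add {d : ℕ} (p : unitInterval) (v : Site d) (n : ℕ) :
    (bondPercolation (zdGraph d) p).real
        (openCrossing ((· + v) '' (↑(box d (2 * n)) : Set (Site d)))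
          ((· + v) '' (↑(box d n) : Set (Site d)))
          ((· + v) '' (↑(innerBoundary (zdGraph d) (box d (2 * n))) : Set (Site d)))) =
      (bondPercolation (zdGraph d) p).real (annulusCrossing d n) :=
  real_openCrossing_shift p v _ _ _

/-- **Union bound**: `P_p(⋃_{v ∈ I} T_v) ≤ |I| · a_n` (`measureReal_biUnion_finset_le` and
`real_openCrossing_add`). -/
theorem real_biUnion_le {d : ℕ} (p : unitInterval) (n : ℕ) (I : Finset (Site d)) :
    (bondPercolation (zdGraph d) p).real (⋃ v ∈ I,
        openCrossing ((· + v) '' (↑(box d (2 * n)) : Set (Site d)))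
          ((· + v) '' (↑(box d n) : Set (Site d)))
          ((· + v) '' (↑(innerBoundary (zdGraph d) (box d (2 * n))) : Set (Site d)))) ≤
      I.card * (bondPercolation (zdGraph d) p).real (annulusCrossing d n) := by
  refine le_trans (measureReal_biUnion_finset_le I _) (le_of_eq ?_)
  rw [Finset.sum_congr rfl fun v _ => real_openCrossing_add p v n, Finset.sum_const, nsmul_eq_mul]

/-- **Locality**: if `v + Λ_{2n} ⊆ S` then `T_v` is determined by the pairs inside `S`
(`DCT16.determinedBy_openConnIn`, unions of determined events; Grimmett 1999 §2.2). -/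
theorem determinedBy_openCrossing_add {d n : ℕ} (v : Site d) {S : Finset (Site d)}
    (hS : ∀ z ∈ box d (2 * n), z + v ∈ S) :
    DeterminedBy (openCrossing ((· + v) '' (↑(box d (2 * n)) : Set (Site d)))
        ((· + v) '' (↑(box d n) : Set (Site d)))
        ((· + v) '' (↑(innerBoundary (zdGraph d) (box d (2 * n))) : Set (Site d))))
      (↑S.sym2 : Set (Sym2 (Site d))) := by
  have hS' : ∀ a ∈ (· + v) '' (↑(box d (2 * n)) : Set (Site d)), a ∈ (↑S : Set (Site d)) := by
    intro a ha
    have h := hS (a - v) ((mem_image_add_iff v a _).1 ha)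
    rwa [sub_add_cancel] at h
  have hsub : ((· + v) '' (↑(box d (2 * n)) : Set (Site d))).sym2 ⊆ (↑S.sym2 : Set (Sym2 (Site d))) := by
    rw [Finset.coe_sym2]
    intro e
    induction e using Sym2.ind with
    | _ a b =>
      intro hab
      rw [Set.mk_mem_sym2_iff] at hab ⊢
      exact ⟨hS' a hab.1, hS' b hab.2⟩
  have hrepr : openCrossing ((· + v) '' (↑(box d (2 * n)) : Set (Site d)))
        ((· + v) '' (↑(box d n) : Set (Site d)))
        ((· + v) '' (↑(innerBoundary (zdGraph d) (box d (2 * n))) : Set (Site d))) =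
      ⋃ x ∈ (· + v) '' (↑(box d n) : Set (Site d)),
        ⋃ y ∈ (· + v) '' (↑(innerBoundary (zdGraph d) (box d (2 * n))) : Set (Site d)),
          openConnIn ((· + v) '' (↑(box d (2 * n)) : Set (Site d))) x y := by
    ext ω
    simp only [mem_openCrossing_iff, Set.mem_iUnion, exists_prop]
  rw [hrepr]
  exact DeterminedBy.iUnion fun x => DeterminedBy.iUnion fun _ => DeterminedBy.iUnion fun y =>
    DeterminedBy.iUnion fun _ => determinedBy_openConnIn _ x y hsub

/-- Locality of the union events `U = ⋃_{v ∈ I} T_v`: if `v + Λ_{2n} ⊆ S` for all `v ∈ I`, then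
`U` is determined by the pairs inside `S`. -/
theorem determinedBy_biUnion {d n : ℕ} (I S : Finset (Site d))
    (hIS : ∀ v ∈ I, ∀ z ∈ box d (2 * n), z + v ∈ S) :
    DeterminedBy (⋃ v ∈ I,
        openCrossing ((· + v) '' (↑(box d (2 * n)) : Set (Site d)))
          ((· + v) '' (↑(box d n) : Set (Site d)))
          ((· + v) '' (↑(innerBoundary (zdGraph d) (box d (2 * n))) : Set (Site d))))
      (↑S.sym2 : Set (Sym2 (Site d))) :=
  DeterminedBy.iUnion fun v => DeterminedBy.iUnion fun hv => determinedBy_openCrossing_add v (hIS v hv)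

/-- Disjoint sets of sites carry disjoint sets of pairs. -/
theorem disjoint_sym2 {d : ℕ} {S₁ S₂ : Finset (Site d)} (h : Disjoint S₁ S₂) :
    Disjoint S₁.sym2 S₂.sym2 := by
  rw [Finset.disjoint_left] at h ⊢
  intro e
  induction e using Sym2.ind with
  | _ a b =>
    intro h₁ h₂
    rw [Finset.mk_mem_sym2_iff] at h₁ h₂
    exact h h₁.1 h₂.1

/-- **Independence and union bound**: if the events `T_v`, `v ∈ I₁`, live on `S₁` and the events
`T_v`, `v ∈ I₂`, live on `S₂` with `S₁ ∩ S₂ = ∅`, then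
`P_p(U₁ ∩ U₂) = P_p(U₁) P_p(U₂) ≤ (|I₁| a_n) (|I₂| a_n)`
(`DCT16.real_inter_of_determinedBy_disjoint`, Grimmett 1999 §2.2; `real_biUnion_le`). -/
theorem real_inter_biUnion_le {d : ℕ} (p : unitInterval) (n : ℕ) (I₁ I₂ S₁ S₂ : Finset (Site d))
    (h₁ : ∀ v ∈ I₁, ∀ z ∈ box d (2 * n), z + v ∈ S₁)
    (h₂ : ∀ v ∈ I₂, ∀ z ∈ box d (2 * n), z + v ∈ S₂) (hS : Disjoint S₁ S₂) :
    (bondPercolation (zdGraph d) p).real ((⋃ v ∈ I₁,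
        openCrossing ((· + v) '' (↑(box d (2 * n)) : Set (Site d)))
          ((· + v) '' (↑(box d n) : Set (Site d)))
          ((· + v) '' (↑(innerBoundary (zdGraph d) (box d (2 * n))) : Set (Site d)))) ∩
      (⋃ v ∈ I₂,
        openCrossing ((· + v) '' (↑(box d (2 * n)) : Set (Site d)))
          ((· + v) '' (↑(box d n) : Set (Site d)))
          ((· + v) '' (↑(innerBoundary (zdGraph d) (box d (2 * n))) : Set (Site d))))) ≤
      (I₁.card * (bondPercolation (zdGraph d) p).real (annulusCrossing d n)) *
        (I₂.card * (bondPercolation (zdGraph d) p).real (annulusCrossing d n)) := by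
  rw [real_inter_of_determinedBy_disjoint (zdGraph d) p (determinedBy_biUnion I₁ S₁ h₁)
    (determinedBy_biUnion I₂ S₂ h₂) (disjoint_sym2 hS)]
  exact mul_le_mul (real_biUnion_le p n I₁) (real_biUnion_le p n I₂) measureReal_nonneg
    (by positivity)

/-- **Counting**: a subset of the grid `n • Λ_{40}` has at most `81^d ≤ 100^d` points (`card_box`). -/
theorem card_le_of_subset_image {d n : ℕ} {I : Finset (Site d)}
    (hI : I ⊆ (box d 40).image fun z : Site d => (n : ℤ) • z) : (I.card : ℝ) ≤ (100 : ℝ) ^ d := by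
  have h1 : I.card ≤ (2 * 40 + 1) ^ d :=
    (Finset.card_le_card hI).trans (Finset.card_image_le.trans (card_box d 40).le)
  calc (I.card : ℝ) ≤ ((2 * 40 + 1) ^ d : ℕ) := by exact_mod_cast h1
    _ = (81 : ℝ) ^ d := by norm_num
    _ ≤ (100 : ℝ) ^ d := pow_le_pow_left₀ (by norm_num) (by norm_num) d

end StubAnnulusCrossingRenorm

/-- **Registered stub `stub_annulusCrossing_renorm`** (line `root-trick-wall-patch`, crux
`SubpolynomialBlocking`): the RENORMALISATION INEQUALITY `a_{20n} ≤ (100^d a_n)²` for the annulus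
crossing probabilities `a_n = P_p(Λ_n ⟷ ∂ⁱⁿΛ_{2n} in Λ_{2n})` of `ℤ^d` (every `d`, every `p`, every
`n ≥ 1`). Proof: on lattice configurations a crossing of `Λ_{40n} ∖ Λ_{20n}` contains two local
crossings `T_{x₁}`, `T_{x₂}` of translated copies of `Λ_{2n} ∖ Λ_n` centred at grid points
`x₁ ∈ nΛ_{40} ∩ Λ_{26n} ∖ Λ_{24n}`, `x₂ ∈ nΛ_{40} ∩ Λ_{34n} ∖ Λ_{32n}` (last exits from `Λ_{25n}`,
`Λ_{33n}` and first exits from the translated boxes,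
`StubAnnulusCrossingRenorm.mem_inter_of_mem_annulusCrossing`); the two families live on the
disjoint shells `Λ_{28n} ∖ Λ_{22n}` and `Λ_{36n} ∖ Λ_{30n}`, so their unions are independent
(`StubAnnulusCrossingRenorm.real_inter_biUnion_le`), each of probability at most
`81^d a_n ≤ 100^d a_n` by the union bound and translation invariance. -/
theorem stub_annulusCrossing_renorm : ∀ (d : ℕ) (p : unitInterval) (n : ℕ), 1 ≤ d → 1 ≤ n → (bondPercolation (zdGraph d) p).real (Literature.Barriers.CriticalPhenomena.annulusCrossing d (20 * n)) ≤ ((100 : ℝ) ^ d * (bondPercolation (zdGraph d) p).real (Literature.Barriers.CriticalPhenomena.annulusCrossing d n)) ^ 2 := by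
  intro d p n _ hn
  have hI₁ : (((((box d 40).image fun z : Site d => (n : ℤ) • z) ∩ box d (26 * n)) \
      box d (24 * n)).card : ℝ) ≤ (100 : ℝ) ^ d :=
    StubAnnulusCrossingRenorm.card_le_of_subset_image
      (Finset.sdiff_subset.trans Finset.inter_subset_left)
  have hI₂ : (((((box d 40).image fun z : Site d => (n : ℤ) • z) ∩ box d (34 * n)) \
      box d (32 * n)).card : ℝ) ≤ (100 : ℝ) ^ d :=
    StubAnnulusCrossingRenorm.card_le_of_subset_image
      (Finset.sdiff_subset.trans Finset.inter_subset_left)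
  have hS : Disjoint (box d (28 * n) \ box d (22 * n)) (box d (36 * n) \ box d (30 * n)) :=
    Finset.disjoint_left.2 fun a ha₁ ha₂ =>
      (Finset.mem_sdiff.1 ha₂).2 (box_mono d (by omega) (Finset.mem_sdiff.1 ha₁).1)
  have h₁ : ∀ v ∈ (((box d 40).image fun z : Site d => (n : ℤ) • z) ∩ box d (26 * n)) \
      box d (24 * n), ∀ z ∈ box d (2 * n), z + v ∈ box d (28 * n) \ box d (22 * n) :=
    fun v hv z hz => StubAnnulusCrossingRenorm.add_mem_sdiff (L := 26 * n) (M := 24 * n)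
      (by omega) (by omega) (Finset.mem_inter.1 (Finset.mem_sdiff.1 hv).1).2
      (Finset.mem_sdiff.1 hv).2 hz
  have h₂ : ∀ v ∈ (((box d 40).image fun z : Site d => (n : ℤ) • z) ∩ box d (34 * n)) \
      box d (32 * n), ∀ z ∈ box d (2 * n), z + v ∈ box d (36 * n) \ box d (30 * n) :=
    fun v hv z hz => StubAnnulusCrossingRenorm.add_mem_sdiff (L := 34 * n) (M := 32 * n)
      (by omega) (by omega) (Finset.mem_inter.1 (Finset.mem_sdiff.1 hv).1).2
      (Finset.mem_sdiff.1 hv).2 hz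
  have hmain := StubAnnulusCrossingRenorm.real_inter_biUnion_le p n _ _ _ _ h₁ h₂ hS
  have ha : 0 ≤ (bondPercolation (zdGraph d) p).real (annulusCrossing d n) := measureReal_nonneg
  calc (bondPercolation (zdGraph d) p).real (annulusCrossing d (20 * n))
      ≤ _ := real_mono_of_forall_subset_edgeSet (zdGraph d) p fun ω hω h =>
          StubAnnulusCrossingRenorm.mem_inter_of_mem_annulusCrossing hn hω h
    _ ≤ _ := hmain
    _ ≤ ((100 : ℝ) ^ d * (bondPercolation (zdGraph d) p).real (annulusCrossing d n)) *
          ((100 : ℝ) ^ d * (bondPercolation (zdGraph d) p).real (annulusCrossing d n)) :=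
        mul_le_mul (mul_le_mul_of_nonneg_right hI₁ ha) (mul_le_mul_of_nonneg_right hI₂ ha)
          (by positivity) (by positivity)
    _ = ((100 : ℝ) ^ d * (bondPercolation (zdGraph d) p).real (annulusCrossing d n)) ^ 2 :=
        (sq _).symm

end Summit.CriticalPhenomena.PercolationContinuityZ3.Theorems.SubpolynomialBlocking

end
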